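import Mathlib
import Literature.LinearAlgebra.TensorNetworks.QuanticsTensorTrain
import Literature.LinearAlgebra.Matrix.FrobeniusNormSingularValues

/-!
# The TT-SVD: sequential orthogonal projections, the error identity, and the
# Oseledets–Tyrtyshnikov error bounds

THE TENSOR-TRAIN SVD [Oseledets2011, §2; UschmajewVandereycken2020, §3.2] computes a tensor train
(`TensorTrain`, see `QuanticsTensorTrain`) approximating a tensor `A : σ^L → ℝ` by a LEFT-TO-RIGHT
SWEEP: with `k` legs absorbed and incoming bond dimension `r`, the current coefficient tensor
`C : r × σ^{L-k}` is reshaped to the `(r·|σ|) × |σ|^{L-k-1}` STEP MATRIX `M` (rows = (bond index,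
next leg)), a matrix `U` with `q ≤ r_{k+1}` orthonormal columns is chosen (leading left singular
vectors of `M`), `U` — reshaped — is the next core, and the sweep continues with `C' = Uᵀ M`.
Its analysis rests on two facts:

* THE ERROR IDENTITY (Pythagoras).  For ANY choice of matrices `U` with orthonormal columns the
  resulting train `B` satisfies `‖A − B‖_F² = Σ_steps ‖M − U Uᵀ M‖_F²`: at each step
  `‖M − U N‖_F² = ‖M − U Uᵀ M‖_F² + ‖Uᵀ M − N‖_F²` for every `N`, and with `N` the value matrix of
  the rest of the train the second term is the error of the rest of the sweep
  [UschmajewVandereycken2020, §3.2, the orthogonality argument for (28)].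
* THE INTERFACE INDUCTION.  Along the sweep the coefficients are `C = Wᵀ A_⟨k⟩` with `A_⟨k⟩` the
  `k`-th UNFOLDING MATRIX of the ORIGINAL tensor (`|σ|^k × |σ|^{L-k}`, legs `< k` against legs
  `≥ k`) and `W` a matrix with orthonormal columns; hence `M = W̃ᵀ A_⟨k+1⟩` with `W̃ = W ⊗ 1_σ`
  again with orthonormal columns, and since `X ↦ W̃ᵀ X` does not increase Frobenius norms and
  does not increase ranks, the loss of an OPTIMAL projection at that step is at most
  `ε_{k+1}² = dist_F(A_⟨k+1⟩, rank ≤ r_{k+1})² = Σ_{j > r_{k+1}} σ_j(A_⟨k+1⟩)²` (Eckart–Young)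
  [Oseledets2011, §2; UschmajewVandereycken2020, §3.2, the argument for (29)].

Consequences [OseledetsTyrtyshnikov2010, Thm 2.2; Oseledets2011, §2; UschmajewVandereycken2020,
§3.2 (28)–(30)]: `‖A − ttSVD(A)‖_F ≤ (Σ_{k=1}^{L-1} ε_k²)^{1/2}`; if `rank A_⟨k⟩ ≤ r_k` for all `k`
the TT-SVD is EXACT, so every tensor is represented exactly by a train with bond dimensions
`rank A_⟨k⟩` (and by none with a smaller bond, `TensorTrain.rank_unfolding_le`); QUASI-OPTIMALITY
`‖A − ttSVD(A)‖_F ≤ √(L−1) · ‖A − T'‖_F` for every train `T'` with bond dimensions `≤ r_k`.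

This file formalises these statements over `ℝ`, for tensors `A : (Fin L → σ) → ℝ` with a finite leg
type `σ`, all errors written as sums of squares (`Σ_s (A s − B s)² = ‖A − B‖_F²`):

* Matrices `U` with ORTHONORMAL COLUMNS (`Uᵀ U = 1`): `dotProduct_self_sub_mulVec_eq`,
  `sum_sq_sub_mul_eq` (Pythagoras `‖M − U N‖² = ‖M − U Uᵀ M‖² + ‖Uᵀ M − N‖²`),
  `sum_sq_transpose_mul_le` (`‖Uᵀ M‖_F ≤ ‖M‖_F`), `sum_sq_sub_proj_le` (the projection beats every
  matrix in the range of `U`),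
  `exists_transpose_mul_self_eq_one_mul_eq` (an orthonormal basis `U` of the column space of `B`:
  `rank B` columns, `U Uᵀ B = B`), `exists_orthonormalCols_proj_optimal` (THE OPTIMAL STEP: `≤ c`
  orthonormal columns whose projection beats every rank-`≤ c` matrix, from the matrix Eckart–Young
  theorem `Literature.LinearAlgebra.Matrix.exists_rank_le_sum_sq_norm_entry_sub_eq`)
  [GolubVanLoan2013, §2.4].
* Trains built from the left: `TensorTrain.evalVec`, `TensorTrain.evalAt` (components of the value
  vector `M_0^{s_0} ⋯ M_{n-1}^{s_{n-1}} · rbdry` before the left boundary is contracted),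
  `TensorTrain.nil`, `TensorTrain.cons` (prepend a site), `TensorTrain.leftProd_cons_apply`,
  `TensorTrain.evalAt_cons` (`T_α(a, t) = Σ_β G^{a}_{αβ} T'_β(t)`).
* The sweep: `unfolding A k m h` (the unfolding matrix `A_⟨k⟩`, `k + m = L`), `stepMatrix`,
  `SelectionRule`, `ttSweep` (the recursion, for an ARBITRARY selection rule), `sweepLoss`,
  `ttSweep_lbdry`, `ttSweep_r_last`, `ttSweep_r_le` (the bond dimensions are the chosen ones);
  `sum_sq_sub_evalAt_ttSweep` — THE ERROR IDENTITY; `sweepLoss_le` — THE INTERFACE INDUCTION.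
* The TT-SVD: `svdSel` (the truncated-SVD selection rule), `svdSel_spec`, `ttSVD rk A`,
  `ttSVD_r_zero`, `ttSVD_lbdry`, `ttSVD_r_last`, `ttSVD_r_le` (TT-ranks `≤ rk k`);
  `sum_sq_sub_eval_ttSVD_le` — THE ERROR BOUND, for any `b k ≥ dist_F(A_⟨k⟩, rank ≤ rk k)²`;
  `sum_sq_sub_eval_ttSVD_le_of_singularValues` — the same with the singular-value tails
  `Σ_{j ≥ rk k} σ_j(A_⟨k⟩)²` (Mathlib's `LinearMap.singularValues` of `Matrix.toEuclideanLin A_⟨k⟩`,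
  zero-indexed and decreasing); `exists_tensorTrain_sum_sq_sub_eval_le` (existence form);
  `eval_ttSVD_eq`, `exists_tensorTrain_eval_eq_rank_le` — THE EXACT CASE, TT-ranks are unfolding
  ranks; `sum_sq_sub_eval_ttSVD_le_mul` — QUASI-OPTIMALITY (factor `L − 1` on squared errors).

Conventions: sites `0, …, L-1`, configurations `s : Fin L → σ`; bond `k` (`0 < k < L`) separates
legs `< k` from legs `≥ k` and `rk : ℕ → ℕ` prescribes its dimension; the TT-SVD has boundary bond
dimensions `1` and boundary vectors `1`.  The selection rule is OBTAINED BY CHOICE from the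
Eckart–Young theorem: what is formalised is the recursion of the algorithm and its error analysis,
not a numerical SVD routine.

Not formalised: the right-to-left and two-sided sweeps and `μ`-orthogonality of the output
[UschmajewVandereycken2020, §3.1 (24)] (the chosen `U` do have orthonormal columns, `svdSel_spec`);
TT-rounding of a tensor already given in TT format and the operation counts; the `ε`-adaptive
choice of ranks (truncating each unfolding at tail `≤ ε²/(L−1) · ‖A‖_F²` gives relative error `ε`
— immediate from `sum_sq_sub_eval_ttSVD_le`); the TT-cross / skeleton algorithms of
[OseledetsTyrtyshnikov2010]; complex scalars.

References: I. V. Oseledets, *Tensor-train decomposition*, SIAM J. Sci. Comput. 33 (2011)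
2295–2317 (`Oseledets2011`), §2 (the TT-SVD algorithm, exact representation with the unfolding
ranks, the error bound, quasi-optimality; the quasi-optimality inequality as quoted in N. Lee,
A. Cichocki, *Fundamental tensor operations for large-scale data analysis in tensor train
formats*, arXiv:1405.7786, §3); I. V. Oseledets, E. E. Tyrtyshnikov, *TT-cross approximation for
multidimensional arrays*, Linear Algebra Appl. 432 (2010) 70–88 (`OseledetsTyrtyshnikov2010`),
Thm 2.2 (existence of a train with TT-ranks `r_k` within `(Σ_k ε_k²)^{1/2}`,
`ε_k = dist_F(A_⟨k⟩, rank ≤ r_k)`; as restated in arXiv:1908.04010, Prop. 4.2); A. Uschmajew,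
B. Vandereycken, *Geometric methods on low-rank matrix and tensor manifolds*, in: Handbook of
Variational Methods for Nonlinear Geometric Data, Springer 2020, 261–313
(`UschmajewVandereycken2020`), §3.1 (TT rank = unfolding ranks), §3.2 (TT-SVD and quasi-optimal
rank truncation: (28)–(30) and the proof sketch); G. H. Golub, C. F. Van Loan, *Matrix
Computations*, 4th ed., Johns Hopkins University Press 2013 (`GolubVanLoan2013`), §2.4 (SVD and
the Eckart–Young theorem).  The organisation of the proof — an exact error identity for an
arbitrary orthonormal selection rule plus the interface induction — is this file's rendering of
the orthogonality argument of [UschmajewVandereycken2020, §3.2]; theorem numbers of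
[Oseledets2011] are not quoted because only secondary restatements of that paper were available
to the formaliser.

AI-produced formalisation (H21 engines group, seat eng-quad-2, 2026-08-22); no facts, no axioms
beyond Mathlib's, no `sorry`.
-/

open Matrix Finset Module

namespace Literature.LinearAlgebra.TensorNetworks

/-! ### Matrices with orthonormal columns: the projection identity -/

section OrthonormalColumns

variable {ρ κ τ : Type*} [Fintype ρ] [Fintype κ] [DecidableEq κ] [Fintype τ]

/-- [folklore] `Σ_i v_i² = v ⬝ v`. -/
private theorem sum_sq_eq_dotProduct (v : ρ → ℝ) : ∑ i, v i ^ 2 = v ⬝ᵥ v := by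
  simp [dotProduct, sq]

/-- THE PROJECTION IDENTITY (vector form): if `U` has orthonormal columns (`Uᵀ U = 1`) then for
every `x` and every coefficient vector `c`,
`‖x − U c‖² = ‖x − U Uᵀ x‖² + ‖Uᵀ x − c‖²` — the orthogonal projection `U Uᵀ x` is the best
approximation of `x` from the column space of `U`, with an exact Pythagorean remainder.
[cite: GolubVanLoan2013, §2.4.2] -/
theorem dotProduct_self_sub_mulVec_eq (U : Matrix ρ κ ℝ) (hU : Uᵀ * U = 1) (x : ρ → ℝ)
    (c : κ → ℝ) :
    (x - U *ᵥ c) ⬝ᵥ (x - U *ᵥ c) =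
      (x - U *ᵥ (Uᵀ *ᵥ x)) ⬝ᵥ (x - U *ᵥ (Uᵀ *ᵥ x)) + (Uᵀ *ᵥ x - c) ⬝ᵥ (Uᵀ *ᵥ x - c) := by
  set p := x - U *ᵥ (Uᵀ *ᵥ x) with hp
  set d := Uᵀ *ᵥ x - c with hd
  have hsplit : x - U *ᵥ c = p + U *ᵥ d := by
    rw [hp, hd, Matrix.mulVec_sub]
    abel
  have hUtp : Uᵀ *ᵥ p = 0 := by
    rw [hp, Matrix.mulVec_sub, Matrix.mulVec_mulVec, hU, Matrix.one_mulVec, sub_self]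
  have hiso : (U *ᵥ d) ⬝ᵥ (U *ᵥ d) = d ⬝ᵥ d := by
    rw [Matrix.dotProduct_mulVec, ← Matrix.mulVec_transpose, Matrix.mulVec_mulVec, hU,
      Matrix.one_mulVec]
  have hcross : p ⬝ᵥ (U *ᵥ d) = 0 := by
    rw [Matrix.dotProduct_mulVec, ← Matrix.mulVec_transpose, hUtp, zero_dotProduct]
  rw [hsplit, add_dotProduct, dotProduct_add, dotProduct_add, hcross, dotProduct_comm (U *ᵥ d) p,
    hcross, hiso]
  ring

/-- [folklore] `Σ_{i,j} X_ij² = Σ_j (column j) ⬝ (column j)`. -/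
private theorem sum_sum_sq_eq_sum_dotProduct_col {ι : Type*} [Fintype ι] (X : Matrix ι τ ℝ) :
    ∑ i, ∑ j, X i j ^ 2 = ∑ j, (fun i => X i j) ⬝ᵥ (fun i => X i j) := by
  rw [Finset.sum_comm]
  exact Finset.sum_congr rfl fun j _ => sum_sq_eq_dotProduct _

/-- THE PROJECTION IDENTITY (matrix / Frobenius form): if `Uᵀ U = 1` then for all `M`, `N`,
`‖M − U N‖_F² = ‖M − U Uᵀ M‖_F² + ‖Uᵀ M − N‖_F²` (apply the vector form column by column).  In
particular `U Uᵀ M` is the best Frobenius approximation of `M` among all matrices `U N` with the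
given column space, `‖U D‖_F = ‖D‖_F`, and `‖Uᵀ M‖_F ≤ ‖M‖_F`.  [cite: GolubVanLoan2013, §2.4.2] -/
theorem sum_sq_sub_mul_eq (U : Matrix ρ κ ℝ) (hU : Uᵀ * U = 1) (M : Matrix ρ τ ℝ)
    (N : Matrix κ τ ℝ) :
    ∑ i, ∑ j, (M - U * N) i j ^ 2 =
      ∑ i, ∑ j, (M - U * (Uᵀ * M)) i j ^ 2 + ∑ β, ∑ j, (Uᵀ * M - N) β j ^ 2 := by
  rw [sum_sum_sq_eq_sum_dotProduct_col (M - U * N), sum_sum_sq_eq_sum_dotProduct_col (M - U * (Uᵀ * M)),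
    sum_sum_sq_eq_sum_dotProduct_col (Uᵀ * M - N), ← Finset.sum_add_distrib]
  refine Finset.sum_congr rfl fun j _ => ?_
  have h1 : (fun i => (M - U * N) i j) = (fun i => M i j) - U *ᵥ fun β => N β j := rfl
  have h2 : (fun i => (M - U * (Uᵀ * M)) i j) =
      (fun i => M i j) - U *ᵥ (Uᵀ *ᵥ fun i => M i j) := by
    funext i
    simp only [Pi.sub_apply, Matrix.sub_apply, Matrix.mulVec, dotProduct, Matrix.mul_apply,
      Matrix.transpose_apply]
  have h3 : (fun β => (Uᵀ * M - N) β j) = (Uᵀ *ᵥ fun i => M i j) - fun β => N β j := by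
    funext β
    simp only [Pi.sub_apply, Matrix.sub_apply, Matrix.mulVec, dotProduct, Matrix.mul_apply,
      Matrix.transpose_apply]
  rw [h1, h2, h3]
  exact dotProduct_self_sub_mulVec_eq U hU _ _

/-- Contraction: `‖Uᵀ M‖_F² ≤ ‖M‖_F²` when `Uᵀ U = 1`.  [cite: GolubVanLoan2013, §2.4.2] -/
theorem sum_sq_transpose_mul_le (U : Matrix ρ κ ℝ) (hU : Uᵀ * U = 1) (M : Matrix ρ τ ℝ) :
    ∑ β, ∑ j, (Uᵀ * M) β j ^ 2 ≤ ∑ i, ∑ j, M i j ^ 2 := by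
  have h := sum_sq_sub_mul_eq U hU M 0
  rw [Matrix.mul_zero, sub_zero, sub_zero] at h
  rw [h]
  exact le_add_of_nonneg_left (by positivity)

/-- Best approximation from a column space: if the columns of `B` lie in the column space of `U`
(`U (Uᵀ B) = B`) and `Uᵀ U = 1`, then `‖M − U Uᵀ M‖_F² ≤ ‖M − B‖_F²`.
[cite: GolubVanLoan2013, §2.4.2] -/
theorem sum_sq_sub_proj_le (U : Matrix ρ κ ℝ) (hU : Uᵀ * U = 1) (M B : Matrix ρ τ ℝ)
    (hB : U * (Uᵀ * B) = B) :
    ∑ i, ∑ j, (M - U * (Uᵀ * M)) i j ^ 2 ≤ ∑ i, ∑ j, (M - B) i j ^ 2 := by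
  have h := sum_sq_sub_mul_eq U hU M (Uᵀ * B)
  rw [hB] at h
  rw [h]
  exact le_add_of_nonneg_right (by positivity)

/-- [folklore] A product of two matrices with orthonormal columns has orthonormal columns:
`(V U)ᵀ (V U) = Uᵀ (Vᵀ V) U = Uᵀ U = 1`. -/
private theorem transpose_mul_self_mul_eq_one {μ : Type*} [Fintype μ] [DecidableEq μ] (V : Matrix ρ κ ℝ)
    (hV : Vᵀ * V = 1) (U : Matrix κ μ ℝ) (hU : Uᵀ * U = 1) : (V * U)ᵀ * (V * U) = 1 := by
  rw [Matrix.transpose_mul, Matrix.mul_assoc, ← Matrix.mul_assoc Vᵀ, hV, Matrix.one_mul, hU]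

variable [DecidableEq τ]

/-- AN ORTHONORMAL BASIS OF THE COLUMN SPACE: every real matrix `B` factors as `B = U (Uᵀ B)` with
`U` a `|ρ| × rank B` matrix with orthonormal columns (an orthonormal basis of the range of `B`).
[cite: GolubVanLoan2013, §2.4.2] -/
theorem exists_transpose_mul_self_eq_one_mul_eq (B : Matrix ρ τ ℝ) :
    ∃ U : Matrix ρ (Fin B.rank) ℝ, Uᵀ * U = 1 ∧ U * (Uᵀ * B) = B := by
  classical
  let S : Submodule ℝ (EuclideanSpace ℝ ρ) := LinearMap.range (Matrix.toEuclideanLin B)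
  have hS : finrank ℝ S = B.rank :=
    (Matrix.rank_eq_finrank_range_toLin B (EuclideanSpace.basisFun ρ ℝ).toBasis
      (EuclideanSpace.basisFun τ ℝ).toBasis).symm
  let v : OrthonormalBasis (Fin B.rank) ℝ S := (stdOrthonormalBasis ℝ S).reindex (finCongr hS)
  have hinner : ∀ (y z : S), inner ℝ y z =
      ∑ i, (y : EuclideanSpace ℝ ρ) i * (z : EuclideanSpace ℝ ρ) i := by
    intro y z
    rw [Submodule.coe_inner, EuclideanSpace.inner_eq_star_dotProduct, star_trivial, dotProduct_comm]
    rfl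
  refine ⟨Matrix.of fun i β => (v β : EuclideanSpace ℝ ρ) i, ?_, ?_⟩
  · ext β β'
    have h := (orthonormal_iff_ite.mp v.orthonormal) β β'
    rw [hinner] at h
    simp only [Matrix.mul_apply, Matrix.transpose_apply, Matrix.of_apply, Matrix.one_apply]
    rw [← h]
  · ext i j
    let y : S := ⟨Matrix.toEuclideanLin B (EuclideanSpace.single j 1), LinearMap.mem_range_self _ _⟩
    have hy : ∀ i', (y : EuclideanSpace ℝ ρ) i' = B i' j := by
      intro i'
      simp [y, Matrix.toLpLin_apply, PiLp.ofLp_single]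
    have hrepr := congrArg (fun z : S => (z : EuclideanSpace ℝ ρ) i) (v.sum_repr' y)
    simp only [Submodule.coe_sum, Submodule.coe_smul, WithLp.ofLp_sum, WithLp.ofLp_smul,
      Finset.sum_apply, Pi.smul_apply, smul_eq_mul, hinner, hy] at hrepr
    simp only [Matrix.mul_apply, Matrix.transpose_apply, Matrix.of_apply]
    rw [← hrepr]
    exact Finset.sum_congr rfl fun β _ => mul_comm _ _

/-- THE OPTIMAL PROJECTION STEP (Eckart–Young, projection form): for every real matrix `M` and rank
budget `c` there is a matrix `U` with `q ≤ c` orthonormal columns such that the orthogonal projection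
`U Uᵀ M` of `M` onto their span is a best Frobenius approximation of `M` among ALL matrices of rank
`≤ c`: `‖M − U Uᵀ M‖_F ≤ ‖M − R‖_F` whenever `rank R ≤ c` (take an orthonormal basis of the column
space of the truncated SVD `M_c`).  [cite: GolubVanLoan2013, §2.4.2 Thm 2.4.8] -/
theorem exists_orthonormalCols_proj_optimal (M : Matrix ρ τ ℝ) (c : ℕ) :
    ∃ p : (q : ℕ) × Matrix ρ (Fin q) ℝ, p.1 ≤ c ∧ p.2ᵀ * p.2 = 1 ∧
      ∀ R : Matrix ρ τ ℝ, R.rank ≤ c →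
        ∑ i, ∑ j, (M - p.2 * (p.2ᵀ * M)) i j ^ 2 ≤ ∑ i, ∑ j, (M - R) i j ^ 2 := by
  obtain ⟨B, hBc, -, hBF⟩ :=
    Literature.LinearAlgebra.Matrix.exists_rank_le_sum_sq_norm_entry_sub_eq M c
  obtain ⟨U, hU, hUB⟩ := exists_transpose_mul_self_eq_one_mul_eq B
  refine ⟨⟨B.rank, U⟩, hBc, hU, fun R hR => ?_⟩
  have hnorm : ∀ X : Matrix ρ τ ℝ, ∑ i, ∑ j, ‖X i j‖ ^ 2 = ∑ i, ∑ j, X i j ^ 2 := by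
    intro X
    simp only [Real.norm_eq_abs, sq_abs]
  calc ∑ i, ∑ j, (M - U * (Uᵀ * M)) i j ^ 2
      ≤ ∑ i, ∑ j, (M - B) i j ^ 2 := sum_sq_sub_proj_le U hU M B hUB
    _ = ∑ j ∈ Finset.Ico c (Fintype.card τ), (Matrix.toEuclideanLin M).singularValues j ^ 2 := by
        rw [← hnorm, hBF]
    _ ≤ ∑ i, ∑ j, (M - R) i j ^ 2 := by
        rw [← hnorm (M - R)]
        exact Literature.LinearAlgebra.Matrix.sum_Ico_sq_singularValues_le_sum_sq_norm_entry_sub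
          M R hR

end OrthonormalColumns

/-! ### Trains built site by site from the left: `nil`, `cons`, value vectors -/

namespace TensorTrain

universe u v

variable {K : Type u} [CommSemiring K] {σ : Type v}

/-- The VALUE VECTOR of a train before the left boundary is contracted:
`evalVec s = (core 0 (s 0) ⋯ core (n-1) (s (n-1))) rbdry ∈ K^{r 0}`, so that `eval s = lbdry ⬝ evalVec s`.
[cite: Oseledets2011, §2] -/
def evalVec {n : ℕ} (T : TensorTrain K σ n) (s : Fin n → σ) : Fin (T.r 0) → K :=
  T.leftProd n s *ᵥ T.rbdry

/-- Definitional unfolding: `eval s = lbdry ⬝ evalVec s`.  [cite: Oseledets2011, §2] -/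
theorem eval_eq_dotProduct_evalVec {n : ℕ} (T : TensorTrain K σ n) (s : Fin n → σ) :
    T.eval s = T.lbdry ⬝ᵥ T.evalVec s := rfl

/-- Component `α` of the value vector, read through an identification `T.r 0 = r` of the left bond
dimension (bookkeeping device: the trains produced by the sweep below have left bond dimension `r`
only propositionally).  [cite: Oseledets2011, §2] -/
def evalAt {n : ℕ} (T : TensorTrain K σ n) {r : ℕ} (h : T.r 0 = r) (α : Fin r) (s : Fin n → σ) : K :=
  T.evalVec s (α.cast h.symm)

/-- With `r 0 = 1` and `lbdry = 1` the value of the train is the unique component of its value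
vector.  [cite: Oseledets2011, §2] -/
theorem eval_eq_evalAt {n : ℕ} (T : TensorTrain K σ n) (h : T.r 0 = 1) (hl : T.lbdry = fun _ => 1)
    (s : Fin n → σ) : T.eval s = T.evalAt h 0 s := by
  rw [eval_eq_dotProduct_evalVec, hl]
  unfold evalAt
  simp only [dotProduct, one_mul]
  rw [← (finCongr h.symm).sum_comp, Fin.sum_univ_one, finCongr_apply]

/-- The train with NO sites and bond dimension `r`: value vector `v` (and left boundary `l`).
[cite: Oseledets2011, §2] -/
def nil (r : ℕ) (l v : Fin r → K) : TensorTrain K σ 0 where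
  r := fun _ => r
  core := fun _ _ => 1
  lbdry := l
  rbdry := v

/-- The components of the value vector of the empty train are those of its right boundary
vector.  [cite: Oseledets2011, §2] -/
theorem evalAt_nil (r : ℕ) (l v : Fin r → K) {r' : ℕ}
    (h : (nil r l v : TensorTrain K σ 0).r 0 = r') (α : Fin r') (s : Fin 0 → σ) :
    (nil r l v : TensorTrain K σ 0).evalAt h α s = v (α.cast h.symm) := by
  unfold evalAt evalVec
  rw [leftProd_zero, Matrix.one_mulVec]
  rfl

/-- Bond dimensions of a train with one more site in front: `r₀`, then the old ones shifted.
[cite: Oseledets2011, §2] -/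
def consRank (r₀ : ℕ) (r : ℕ → ℕ) : ℕ → ℕ
  | 0 => r₀
  | ℓ + 1 => r ℓ

/-- Cores of a train with one more site in front: the new core `G` (its column index identified with
the old left bond through `h`), then the old cores shifted.  [cite: Oseledets2011, §2] -/
def consCore {n : ℕ} (T : TensorTrain K σ n) {r₀ r₁ : ℕ} (h : T.r 0 = r₁)
    (G : σ → Matrix (Fin r₀) (Fin r₁) K) :
    (ℓ : ℕ) → σ → Matrix (Fin (consRank r₀ T.r ℓ)) (Fin (consRank r₀ T.r (ℓ + 1))) K
  | 0, a => Matrix.of fun α β => G a α (β.cast h)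
  | ℓ + 1, a => T.core ℓ a

/-- PREPENDING A SITE: the train `s ↦ l · G^{s 0} · M_0^{s 1} ⋯ M_{n-1}^{s n} · rbdry` with `n + 1`
sites obtained from an `n`-site train by a new first core `G` (an `r₀ × r₁` matrix per leg value,
`r₁ = ` the old left bond dimension) and a new left boundary vector `l`.  [cite: Oseledets2011, §2] -/
def cons {n : ℕ} (T : TensorTrain K σ n) {r₀ r₁ : ℕ} (h : T.r 0 = r₁)
    (G : σ → Matrix (Fin r₀) (Fin r₁) K) (l : Fin r₀ → K) : TensorTrain K σ (n + 1) where
  r := consRank r₀ T.r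
  core := consCore T h G
  lbdry := l
  rbdry := T.rbdry

section Cons

variable {n : ℕ} (T : TensorTrain K σ n) {r₀ r₁ : ℕ} (h : T.r 0 = r₁)
  (G : σ → Matrix (Fin r₀) (Fin r₁) K) (l : Fin r₀ → K)

/-- Definitional unfolding: the new left bond dimension.  [cite: Oseledets2011, §2] -/
@[simp] theorem cons_r_zero : (T.cons h G l).r 0 = r₀ := rfl

/-- Definitional unfolding: the old bond dimensions, shifted by one.  [cite: Oseledets2011, §2] -/
@[simp] theorem cons_r_succ (ℓ : ℕ) : (T.cons h G l).r (ℓ + 1) = T.r ℓ := rfl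

/-- Definitional unfolding: the new left boundary vector.  [cite: Oseledets2011, §2] -/
@[simp] theorem cons_lbdry : (T.cons h G l).lbdry = l := rfl

/-- Definitional unfolding: the right boundary vector is kept.  [cite: Oseledets2011, §2] -/
@[simp] theorem cons_rbdry : (T.cons h G l).rbdry = T.rbdry := rfl

/-- Entrywise, the product of the first `k + 1` cores of the extended train is the new core times
the product of the first `k` old cores (stated on entries: the two sides are matrices of
definitionally, not syntactically, equal index types).  [cite: Oseledets2011, §2] -/
theorem leftProd_cons_apply : ∀ (k : ℕ) (s : Fin (k + 1) → σ) (α : Fin r₀) (γ : Fin (T.r k)),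
    (T.cons h G l).leftProd (k + 1) s α γ =
      ∑ β : Fin (T.r 0), G (s 0) α (β.cast h) * T.leftProd k (Fin.tail s) β γ
  | 0, s, α, γ => by
      rw [(T.cons h G l).leftProd_succ 0 s, leftProd_zero, leftProd_zero, Matrix.one_mul]
      simp only [Matrix.one_apply, mul_ite, mul_one, mul_zero, Finset.sum_ite_eq',
        Finset.mem_univ, if_true]
      rfl
  | k + 1, s, α, γ => by
      rw [(T.cons h G l).leftProd_succ (k + 1) s, Matrix.mul_apply]
      simp only [leftProd_cons_apply k (Fin.init s) α]
      simp only [T.leftProd_succ k (Fin.tail s), Matrix.mul_apply, Finset.sum_mul, Finset.mul_sum,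
        Fin.tail_init_eq_init_tail, mul_assoc]
      rw [Finset.sum_comm]
      rfl

/-- Componentwise: `evalAt α (a, t) = Σ_β G^{a}_{αβ} · evalAt β t` — the value vector of the
extended train is the new core applied to the old value vector of the remaining legs.
[cite: Oseledets2011, §2] -/
theorem evalAt_cons (h' : (T.cons h G l).r 0 = r₀) (α : Fin r₀) (s : Fin (n + 1) → σ) :
    (T.cons h G l).evalAt h' α s = ∑ β, G (s 0) α β * T.evalAt h β (Fin.tail s) := by
  subst h
  have hα : Fin.cast h'.symm α = α := Fin.ext rfl
  unfold evalAt evalVec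
  rw [hα]
  simp only [Matrix.mulVec, dotProduct, Fin.cast_refl, id_eq, cons_rbdry, leftProd_cons_apply,
    Finset.sum_mul, Finset.mul_sum, mul_assoc]
  rw [Finset.sum_comm]
  rfl

end Cons

end TensorTrain

/-! ### The left-to-right sweep with an arbitrary orthonormal selection rule -/

section Sweep

variable {σ : Type*} [Fintype σ]

/-- THE `k`-TH UNFOLDING MATRIX of a tensor `A` with `N = k + m` legs: rows indexed by the first `k`
legs, columns by the last `m`, `A_⟨k⟩ (s, t) = A(s ⊕ t)` (same form as in
`TensorTrain.rank_unfolding_le`).  [cite: Oseledets2011, §2] [cite: UschmajewVandereycken2020, §3.2] -/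
def unfolding {N : ℕ} (A : (Fin N → σ) → ℝ) (k m : ℕ) (h : k + m = N) :
    Matrix (Fin k → σ) (Fin m → σ) ℝ :=
  Matrix.of fun s t => A (fun i => Fin.append s t (i.cast h.symm))

/-- THE MATRIX HANDED TO THE SELECTION RULE at a sweep step: the current coefficient tensor
`C : r × σ^{n+1}` (incoming bond index `α`, remaining legs) reshaped with rows `(α, a)` = (bond
index, current leg) and columns `t` = the remaining `n` legs.  [cite: Oseledets2011, §2] -/
def stepMatrix {r n : ℕ} (C : Fin r → (Fin (n + 1) → σ) → ℝ) : Matrix (Fin r × σ) (Fin n → σ) ℝ :=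
  Matrix.of fun q t => C q.1 (Fin.cons q.2 t)

/-- A SELECTION RULE: at step `k` (number of legs already absorbed), given the `(r·|σ|) × |σ|^m`
step matrix, return a bond dimension `q` and an `(r·|σ|) × q` matrix `U` (meant to have orthonormal
columns; for the TT-SVD, leading left singular vectors).  [cite: Oseledets2011, §2] -/
abbrev SelectionRule (σ : Type*) : Type _ :=
  ℕ → (r m : ℕ) → Matrix (Fin r × σ) (Fin m → σ) ℝ → (q : ℕ) × Matrix (Fin r × σ) (Fin q) ℝ

/-- THE SWEEP (the recursion of the TT-SVD / TT-rounding algorithms with an arbitrary selection rule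
`sel`): from a coefficient tensor `C : r × σ^n` (incoming bond dimension `r`, `n` remaining legs,
`k` legs already absorbed) build an `n`-site train with left bond dimension `r`:
no legs — the empty train with value vector `C`; one leg — a single exact core `G^{a}_{α0} = C_α(a)`;
otherwise reshape `C` to the step matrix `M` (rows `(α, a)`), let `sel` choose `U` (`q` columns),
take the new core `G^{a}_{αβ} = U_{(α,a)β}` and CONTINUE WITH THE PROJECTED COEFFICIENTS
`C' = Uᵀ M : q × σ^{n-1}`.  Returned together with the (definitional) fact that the left bond
dimension is `r`.  [cite: Oseledets2011, §2] [cite: UschmajewVandereycken2020, §3.2] -/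
noncomputable def ttSweep (sel : SelectionRule σ) :
    (k n r : ℕ) → (Fin r → (Fin n → σ) → ℝ) → {T : TensorTrain ℝ σ n // T.r 0 = r}
  | _, 0, r, C => ⟨TensorTrain.nil r (fun _ => 1) (fun α => C α Fin.elim0), rfl⟩
  | _, 1, _, C =>
      ⟨(TensorTrain.nil 1 (fun _ => 1) (fun _ => 1)).cons (r₁ := 1) rfl
          (fun a => Matrix.of fun α (_ : Fin 1) => C α (fun _ => a)) (fun _ => 1), rfl⟩
  | k, n + 2, r, C =>
      let p := sel k r (n + 1) (stepMatrix C)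
      let rest := ttSweep sel (k + 1) (n + 1) p.1
        (p.2ᵀ * stepMatrix C : Matrix (Fin p.1) (Fin (n + 1) → σ) ℝ)
      ⟨rest.1.cons rest.2 (fun a => Matrix.of fun α β => p.2 (α, a) β) (fun _ => 1), rfl⟩

/-- THE ACCUMULATED PROJECTION LOSS of the sweep: the sum over the steps of `‖M − U Uᵀ M‖_F²`
(the part of the step matrix discarded by the projection onto the chosen columns).
[cite: Oseledets2011, §2] [cite: UschmajewVandereycken2020, §3.2] -/
noncomputable def sweepLoss (sel : SelectionRule σ) :
    (k n r : ℕ) → (Fin r → (Fin n → σ) → ℝ) → ℝ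
  | _, 0, _, _ => 0
  | _, 1, _, _ => 0
  | k, n + 2, r, C =>
      let p := sel k r (n + 1) (stepMatrix C)
      (∑ q, ∑ t, (stepMatrix C - p.2 * (p.2ᵀ * stepMatrix C)) q t ^ 2) +
        sweepLoss sel (k + 1) (n + 1) p.1
          (p.2ᵀ * stepMatrix C : Matrix (Fin p.1) (Fin (n + 1) → σ) ℝ)

/-- The left boundary vector of a swept train is `1`.  [cite: Oseledets2011, §2] -/
theorem ttSweep_lbdry (sel : SelectionRule σ) (k n r : ℕ) (C : Fin r → (Fin n → σ) → ℝ) :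
    (ttSweep sel k n r C).1.lbdry = fun _ => 1 := by
  match n with
  | 0 => rfl
  | 1 => rfl
  | n + 2 => rfl

/-- The right bond dimension of a swept train with at least one site is `1`.
[cite: Oseledets2011, §2] -/
theorem ttSweep_r_last (sel : SelectionRule σ) :
    ∀ (n k r : ℕ) (C : Fin r → (Fin n → σ) → ℝ), 0 < n → (ttSweep sel k n r C).1.r n = 1
  | 0, _, _, _, h => absurd h (lt_irrefl 0)
  | 1, _, _, _, _ => rfl
  | n + 2, k, _, _, _ => by
      rw [ttSweep]
      exact ttSweep_r_last sel (n + 1) (k + 1) _ _ (Nat.succ_pos n)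

/-- THE BOND DIMENSIONS OF A SWEPT TRAIN ARE THE ONES CHOSEN BY THE SELECTION RULE: if `sel` never
returns more than `rk (k + 1)` columns at step `k`, the interior bond `j` of the train swept from
step `k` has dimension `≤ rk (k + j)`.  [cite: Oseledets2011, §2] -/
theorem ttSweep_r_le (sel : SelectionRule σ) (rk : ℕ → ℕ)
    (hq : ∀ k r m (M : Matrix (Fin r × σ) (Fin m → σ) ℝ), (sel k r m M).1 ≤ rk (k + 1)) :
    ∀ (n k r : ℕ) (C : Fin r → (Fin n → σ) → ℝ) (j : ℕ), 0 < j → j < n →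
      (ttSweep sel k n r C).1.r j ≤ rk (k + j)
  | 0, _, _, _, j, _, hj => absurd hj (Nat.not_lt_zero j)
  | 1, _, _, _, j, hj0, hj1 => by omega
  | n + 2, k, r, C, j, hj0, hjn => by
      rw [ttSweep]
      match j, hj0, hjn with
      | 1, _, _ =>
          show (ttSweep sel (k + 1) (n + 1) _ _).1.r 0 ≤ rk (k + 1)
          rw [(ttSweep sel (k + 1) (n + 1) _ _).2]
          exact hq k r (n + 1) _
      | j + 2, _, hjn =>
          show (ttSweep sel (k + 1) (n + 1) _ _).1.r (j + 1) ≤ rk (k + (j + 2))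
          rw [show k + (j + 2) = k + 1 + (j + 1) by omega]
          exact ttSweep_r_le sel rk hq (n + 1) (k + 1) _ _ (j + 1) (Nat.succ_pos j) (by omega)

/-- [folklore] A sum over `σ^{m+1}` is a sum over the first leg and the remaining `m`. -/
private theorem sum_eq_sum_sum_cons {m : ℕ} (f : (Fin (m + 1) → σ) → ℝ) :
    ∑ s, f s = ∑ a : σ, ∑ t : Fin m → σ, f (Fin.cons a t) := by
  rw [← (Fin.consEquiv fun _ : Fin (m + 1) => σ).sum_comp, Fintype.sum_prod_type]
  rfl

/-- [folklore] A sum over `σ^{m+1}` is a sum over the last leg and the first `m`. -/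
private theorem sum_eq_sum_sum_snoc {m : ℕ} (f : (Fin (m + 1) → σ) → ℝ) :
    ∑ s, f s = ∑ a : σ, ∑ t : Fin m → σ, f (Fin.snoc t a) := by
  rw [← (Fin.snocEquiv fun _ : Fin (m + 1) => σ).sum_comp, Fintype.sum_prod_type]
  rfl

/-- [folklore] ONE STEP OF THE ERROR IDENTITY: prepend the core built from `U = p.2` (orthonormal
columns) to a train `rest` for the projected coefficients; the squared distance to `C` splits, by
Pythagoras in the column space of `U`, into the projection loss of the step plus the squared
distance of the projected coefficients `Uᵀ M` to the values of `rest`. -/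
private theorem step_sum_sq {r n : ℕ} (p : (q : ℕ) × Matrix (Fin r × σ) (Fin q) ℝ)
    (hU : p.2ᵀ * p.2 = 1) (C : Fin r → (Fin (n + 2) → σ) → ℝ)
    (rest : {T : TensorTrain ℝ σ (n + 1) // T.r 0 = p.1})
    (h' : (rest.1.cons rest.2 (fun a => Matrix.of fun α β => p.2 (α, a) β) (fun _ => 1)).r 0 = r) :
    ∑ α, ∑ s, (C α s - (rest.1.cons rest.2 (fun a => Matrix.of fun α β => p.2 (α, a) β)
        (fun _ => 1)).evalAt h' α s) ^ 2 =
      (∑ q, ∑ t, (stepMatrix C - p.2 * (p.2ᵀ * stepMatrix C)) q t ^ 2) +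
        ∑ β, ∑ t, ((p.2ᵀ * stepMatrix C) β t - rest.1.evalAt rest.2 β t) ^ 2 := by
  let N : Matrix (Fin p.1) (Fin (n + 1) → σ) ℝ := Matrix.of fun β t => rest.1.evalAt rest.2 β t
  have hN : ∀ β t, rest.1.evalAt rest.2 β t = N β t := fun _ _ => rfl
  have hstep : ∑ α, ∑ s, (C α s - (rest.1.cons rest.2 (fun a => Matrix.of fun α β => p.2 (α, a) β)
      (fun _ => 1)).evalAt h' α s) ^ 2 = ∑ q, ∑ t, (stepMatrix C - p.2 * N) q t ^ 2 := by
    rw [Fintype.sum_prod_type]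
    refine Finset.sum_congr rfl fun α _ => ?_
    conv_lhs => rw [sum_eq_sum_sum_cons]
    refine Finset.sum_congr rfl fun a _ => Finset.sum_congr rfl fun t _ => ?_
    rw [TensorTrain.evalAt_cons]
    simp only [Fin.cons_zero, Fin.tail_cons, Matrix.of_apply, stepMatrix, Matrix.sub_apply,
      Matrix.mul_apply, hN]
  rw [hstep, sum_sq_sub_mul_eq p.2 hU (stepMatrix C) N]
  simp only [Matrix.sub_apply, hN]

/-- THE ERROR IDENTITY OF THE SWEEP: for ANY selection rule returning matrices with orthonormal
columns, the squared (Frobenius) distance between the coefficient tensor `C` and the swept train is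
EXACTLY the accumulated projection loss, `Σ_{α,s} (C_α(s) − T_α(s))² = Σ_steps ‖M − U Uᵀ M‖_F²`:
at each step `‖M − U N‖_F² = ‖M − U Uᵀ M‖_F² + ‖Uᵀ M − N‖_F²` with `N` the value matrix of the rest
of the train, and the second term is the error of the recursive call.  (The textbook statements give
the inequality `≤`; the identity is the Pythagorean bookkeeping behind them.)
[cite: Oseledets2011, §2] [cite: UschmajewVandereycken2020, §3.2] -/
theorem sum_sq_sub_evalAt_ttSweep (sel : SelectionRule σ)
    (hsel : ∀ k r m (M : Matrix (Fin r × σ) (Fin m → σ) ℝ), (sel k r m M).2ᵀ * (sel k r m M).2 = 1) :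
    ∀ (n k r : ℕ) (C : Fin r → (Fin n → σ) → ℝ),
      ∑ α, ∑ s, (C α s - (ttSweep sel k n r C).1.evalAt (ttSweep sel k n r C).2 α s) ^ 2 =
        sweepLoss sel k n r C
  | 0, k, r, C => by
      rw [sweepLoss]
      refine Finset.sum_eq_zero fun α _ => Finset.sum_eq_zero fun s _ => ?_
      rw [ttSweep, TensorTrain.evalAt_nil, show s = Fin.elim0 from Subsingleton.elim _ _]
      exact (by rw [sub_self, zero_pow two_ne_zero] : (C α Fin.elim0 - C α Fin.elim0) ^ 2 = (0 : ℝ))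
  | 1, k, r, C => by
      rw [sweepLoss]
      refine Finset.sum_eq_zero fun α _ => Finset.sum_eq_zero fun s _ => ?_
      have hs : (fun _ : Fin 1 => s 0) = s := funext fun i => congrArg s (Subsingleton.elim _ _)
      rw [ttSweep, TensorTrain.evalAt_cons, Fin.sum_univ_one, TensorTrain.evalAt_nil, Matrix.of_apply,
        hs, mul_one, sub_self, zero_pow two_ne_zero]
  | n + 2, k, r, C => by
      rw [sweepLoss, ttSweep]
      simp only
      rw [step_sum_sq _ (hsel k r (n + 1) (stepMatrix C)),
        sum_sq_sub_evalAt_ttSweep sel hsel (n + 1) (k + 1)]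

/-! ### The interface induction: the step losses are controlled by the unfoldings of `A` -/

variable [DecidableEq σ]

/-- [folklore] THE LIFTED INTERFACE MATRIX: from `W : σ^k × r` build `W̃ : σ^{k+1} × (r × σ)`,
`W̃_{s', (α, a)} = W_{init s', α} · [s'_k = a]` (`W ⊗ 1_σ` up to the identification
`σ^{k+1} = σ^k × σ`). -/
private def liftW {k r : ℕ} (W : Matrix (Fin k → σ) (Fin r) ℝ) :
    Matrix (Fin (k + 1) → σ) (Fin r × σ) ℝ :=
  Matrix.of fun s q => if s (Fin.last k) = q.2 then W (Fin.init s) q.1 else 0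

/-- [folklore] `W̃` has orthonormal columns if `W` has. -/
private theorem liftW_orthonormal {k r : ℕ} (W : Matrix (Fin k → σ) (Fin r) ℝ) (hW : Wᵀ * W = 1) :
    (liftW W)ᵀ * liftW W = 1 := by
  ext ⟨α, a⟩ ⟨α', a'⟩
  have hαα' : ∑ s, W s α * W s α' = if α = α' then 1 else 0 := by
    simpa only [Matrix.mul_apply, Matrix.transpose_apply, Matrix.one_apply] using
      congrFun (congrFun hW α) α'
  rw [Matrix.mul_apply, sum_eq_sum_sum_snoc]
  simp only [Matrix.transpose_apply, liftW, Matrix.of_apply, Fin.snoc_last, Fin.init_snoc,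
    ite_mul, mul_ite, zero_mul, mul_zero]
  rw [Finset.sum_comm]
  simp only [Finset.sum_ite_eq', Finset.mem_univ, if_true]
  by_cases ha : a' = a
  · subst ha
    simp [hαα', Matrix.one_apply]
  · simp [ha, Ne.symm ha]

/-- [folklore] THE INVARIANT OF THE SWEEP, one step on: if the current coefficients are the
contraction `C = Wᵀ A_⟨k⟩` of the `k`-th unfolding of `A` with a matrix `W` (orthonormal columns),
then the step matrix is the contraction `M = W̃ᵀ A_⟨k+1⟩` of the next unfolding with the lifted
matrix. -/
private theorem stepMatrix_eq_liftW_transpose_mul {N k n r : ℕ} (A : (Fin N → σ) → ℝ)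
    (h : k + (n + 2) = N) (h' : k + 1 + (n + 1) = N) (C : Fin r → (Fin (n + 2) → σ) → ℝ)
    (W : Matrix (Fin k → σ) (Fin r) ℝ) (hC : ∀ β t, C β t = (Wᵀ * unfolding A k (n + 2) h) β t) :
    stepMatrix C = (liftW W)ᵀ * unfolding A (k + 1) (n + 1) h' := by
  ext ⟨α, a⟩ t
  rw [Matrix.mul_apply, sum_eq_sum_sum_snoc]
  simp only [stepMatrix, Matrix.of_apply, hC, Matrix.mul_apply, Matrix.transpose_apply, liftW,
    Fin.snoc_last, Fin.init_snoc, ite_mul, zero_mul, unfolding]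
  rw [Finset.sum_comm]
  simp only [Finset.sum_ite_eq', Finset.mem_univ, if_true]
  refine Finset.sum_congr rfl fun s _ => ?_
  rw [Fin.append_right_cons]
  rfl

/-- THE INTERFACE INDUCTION (the heart of Oseledets' error analysis): along the sweep the
coefficients stay of the form `C = Wᵀ A_⟨k⟩` with `W` having orthonormal columns, so each step
matrix is `M = W̃ᵀ A_⟨k+1⟩` and, if the selection rule is optimal among rank-`≤ rk (k+1)`
approximations, its loss is at most the squared distance of the UNFOLDING `A_⟨k+1⟩` of the
ORIGINAL tensor to the matrices of rank `≤ rk (k+1)` (contracting with `W̃ᵀ` does not increase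
Frobenius norms and maps rank-`≤ rk` matrices to rank-`≤ rk` matrices).  Hence the accumulated
loss is at most `Σ_{i=k+1}^{k+n-1} b_i` for any bounds `b_i ≥ dist(A_⟨i⟩, rank ≤ rk i)²`.
[cite: Oseledets2011, §2] [cite: UschmajewVandereycken2020, §3.2] -/
theorem sweepLoss_le {N : ℕ} (A : (Fin N → σ) → ℝ) (rk : ℕ → ℕ) (b : ℕ → ℝ)
    (hb : ∀ i m (h : i + m = N), 0 < i → 0 < m →
      ∃ R : Matrix (Fin i → σ) (Fin m → σ) ℝ, R.rank ≤ rk i ∧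
        ∑ s, ∑ t, (unfolding A i m h - R) s t ^ 2 ≤ b i)
    (sel : SelectionRule σ)
    (hsel : ∀ k r m (M : Matrix (Fin r × σ) (Fin m → σ) ℝ), (sel k r m M).2ᵀ * (sel k r m M).2 = 1)
    (hopt : ∀ k r m (M R : Matrix (Fin r × σ) (Fin m → σ) ℝ), R.rank ≤ rk (k + 1) →
      ∑ q, ∑ t, (M - (sel k r m M).2 * ((sel k r m M).2ᵀ * M)) q t ^ 2 ≤
        ∑ q, ∑ t, (M - R) q t ^ 2) :
    ∀ (n k r : ℕ) (h : k + n = N) (C : Fin r → (Fin n → σ) → ℝ) (W : Matrix (Fin k → σ) (Fin r) ℝ),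
      Wᵀ * W = 1 → (∀ β t, C β t = (Wᵀ * unfolding A k n h) β t) →
        sweepLoss sel k n r C ≤ ∑ i ∈ Finset.Ico (k + 1) (k + n), b i
  | 0, k, _, _, _, _, _, _ => by
      rw [sweepLoss, Finset.Ico_eq_empty_of_le (by omega), Finset.sum_empty]
  | 1, k, _, _, _, _, _, _ => by
      rw [sweepLoss, Finset.Ico_self, Finset.sum_empty]
  | n + 2, k, r, h, C, W, hW, hC => by
      have h' : k + 1 + (n + 1) = N := by omega
      have hM := stepMatrix_eq_liftW_transpose_mul A h h' C W hC
      have hWt := liftW_orthonormal W hW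
      obtain ⟨R₀, hR₀, hR₀b⟩ := hb (k + 1) (n + 1) h' (Nat.succ_pos k) (Nat.succ_pos n)
      have h1 : ∑ q, ∑ t, (stepMatrix C - (sel k r (n + 1) (stepMatrix C)).2 *
          ((sel k r (n + 1) (stepMatrix C)).2ᵀ * stepMatrix C)) q t ^ 2 ≤ b (k + 1) :=
        calc _ ≤ ∑ q, ∑ t, (stepMatrix C - (liftW W)ᵀ * R₀) q t ^ 2 :=
              hopt k r (n + 1) (stepMatrix C) _ ((Matrix.rank_mul_le_right _ _).trans hR₀)
          _ = ∑ q, ∑ t, ((liftW W)ᵀ * (unfolding A (k + 1) (n + 1) h' - R₀)) q t ^ 2 := by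
              rw [hM, ← Matrix.mul_sub]
          _ ≤ ∑ s, ∑ t, (unfolding A (k + 1) (n + 1) h' - R₀) s t ^ 2 :=
              sum_sq_transpose_mul_le (liftW W) hWt _
          _ ≤ b (k + 1) := hR₀b
      have h2 := sweepLoss_le A rk b hb sel hsel hopt (n + 1) (k + 1) _ h'
        ((sel k r (n + 1) (stepMatrix C)).2ᵀ * stepMatrix C)
        (liftW W * (sel k r (n + 1) (stepMatrix C)).2)
        (transpose_mul_self_mul_eq_one (liftW W) hWt _ (hsel k r (n + 1) _))
        (fun β t => by rw [Matrix.transpose_mul, Matrix.mul_assoc, ← hM])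
      rw [show k + 1 + (n + 1) = k + (n + 2) by omega] at h2
      rw [sweepLoss, Finset.sum_eq_sum_Ico_succ_bot (by omega : k + 1 < k + (n + 2))]
      exact add_le_add h1 h2

/-! ### The TT-SVD: the sweep with an optimal (truncated-SVD) selection rule -/

/-- THE TT-SVD SELECTION RULE with prescribed bond dimensions `rk`: at step `k`, choose
`q ≤ rk (k+1)` orthonormal columns `U` such that the projection `U Uᵀ M` is a best approximation
of the step matrix `M` among ALL matrices of rank `≤ rk (k+1)` — an orthonormal basis of the column
space of a truncated SVD of `M` (Eckart–Young, `exists_rank_le_sum_sq_norm_entry_sub_eq`).  Obtained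
by choice: the algorithmic content formalised here is the recursion `ttSweep` and its analysis, not
an SVD routine.  [cite: Oseledets2011, §2] [cite: GolubVanLoan2013, §2.4] -/
noncomputable def svdSel (rk : ℕ → ℕ) : SelectionRule σ := fun k _ _ M =>
  Classical.choose (exists_orthonormalCols_proj_optimal M (rk (k + 1)))

/-- The defining properties of the TT-SVD selection rule: `≤ rk (k+1)` orthonormal columns whose
projection beats every rank-`≤ rk (k+1)` approximation of the step matrix.
[cite: Oseledets2011, §2] [cite: GolubVanLoan2013, §2.4] -/
theorem svdSel_spec (rk : ℕ → ℕ) (k r m : ℕ) (M : Matrix (Fin r × σ) (Fin m → σ) ℝ) :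
    (svdSel rk k r m M).1 ≤ rk (k + 1) ∧ (svdSel rk k r m M).2ᵀ * (svdSel rk k r m M).2 = 1 ∧
      ∀ R : Matrix (Fin r × σ) (Fin m → σ) ℝ, R.rank ≤ rk (k + 1) →
        ∑ q, ∑ t, (M - (svdSel rk k r m M).2 * ((svdSel rk k r m M).2ᵀ * M)) q t ^ 2 ≤
          ∑ q, ∑ t, (M - R) q t ^ 2 :=
  Classical.choose_spec (exists_orthonormalCols_proj_optimal M (rk (k + 1)))

/-- THE TT-SVD (Oseledets' Algorithm 1 with rank truncation) of a tensor `A : σ^L → ℝ` with target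
bond dimensions `rk 1, …, rk (L-1)`: the left-to-right sweep started from `A` itself (no leg
absorbed, incoming bond dimension `1`) with the truncated-SVD selection rule.
[cite: Oseledets2011, §2] [cite: UschmajewVandereycken2020, §3.2] -/
noncomputable def ttSVD (rk : ℕ → ℕ) {L : ℕ} (A : (Fin L → σ) → ℝ) : TensorTrain ℝ σ L :=
  (ttSweep (svdSel rk) 0 L 1 (fun _ => A)).1

section TTSVD

variable (rk : ℕ → ℕ) {L : ℕ} (A : (Fin L → σ) → ℝ)

/-- The TT-SVD has left bond dimension `1`.  [cite: Oseledets2011, §2] -/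
theorem ttSVD_r_zero : (ttSVD rk A).r 0 = 1 := (ttSweep (svdSel rk) 0 L 1 (fun _ => A)).2

/-- The TT-SVD has left boundary vector `1`.  [cite: Oseledets2011, §2] -/
theorem ttSVD_lbdry : (ttSVD rk A).lbdry = fun _ => 1 := ttSweep_lbdry (svdSel rk) 0 L 1 _

/-- The TT-SVD (of a tensor with at least one leg) has right bond dimension `1`.
[cite: Oseledets2011, §2] -/
theorem ttSVD_r_last (hL : 0 < L) : (ttSVD rk A).r L = 1 := ttSweep_r_last (svdSel rk) L 0 1 _ hL

/-- THE TT-RANKS OF THE TT-SVD ARE AT MOST THE PRESCRIBED ONES: `r_k ≤ rk k` for `0 < k < L`.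
[cite: Oseledets2011, §2] -/
theorem ttSVD_r_le (k : ℕ) (hk : 0 < k) (hkL : k < L) : (ttSVD rk A).r k ≤ rk k := by
  have h := ttSweep_r_le (svdSel rk) rk (fun k r m M => (svdSel_spec rk k r m M).1) L 0 1
    (fun _ => A) k hk hkL
  rwa [Nat.zero_add] at h

/-- THE TT-SVD ERROR BOUND (Oseledets' Theorem 2.2, deterministic form): if for every
`0 < k < L` the `k`-th unfolding `A_⟨k⟩` (a `|σ|^k × |σ|^{L-k}` matrix) is within squared
Frobenius distance `b k` of SOME matrix of rank `≤ rk k`, then the TT-SVD with bond dimensions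
`≤ rk k` satisfies `Σ_s (A(s) − ttSVD(s))² ≤ Σ_{k=1}^{L-1} b k`, i.e.
`‖A − B‖_F ≤ (Σ_k ε_k²)^{1/2}` with `ε_k = dist_F(A_⟨k⟩, rank ≤ r_k)`.
Proof: error identity of the sweep (`sum_sq_sub_evalAt_ttSweep`) + interface induction
(`sweepLoss_le`), started with the empty interface `W = (1) : σ^0 × 1`.
[cite: Oseledets2011, §2] [cite: OseledetsTyrtyshnikov2010, Thm 2.2]
[cite: UschmajewVandereycken2020, §3.2] -/
theorem sum_sq_sub_eval_ttSVD_le (b : ℕ → ℝ)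
    (hb : ∀ k m (h : k + m = L), 0 < k → 0 < m →
      ∃ R : Matrix (Fin k → σ) (Fin m → σ) ℝ, R.rank ≤ rk k ∧
        ∑ s, ∑ t, (unfolding A k m h - R) s t ^ 2 ≤ b k) :
    ∑ s, (A s - (ttSVD rk A).eval s) ^ 2 ≤ ∑ k ∈ Finset.Ico 1 L, b k := by
  have hsel := fun k r m (M : Matrix (Fin r × σ) (Fin m → σ) ℝ) => (svdSel_spec rk k r m M).2.1
  have hopt := fun k r m (M : Matrix (Fin r × σ) (Fin m → σ) ℝ) => (svdSel_spec rk k r m M).2.2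
  have hW₀ : (Matrix.of fun (_ : Fin 0 → σ) (_ : Fin 1) => (1 : ℝ))ᵀ *
      Matrix.of (fun (_ : Fin 0 → σ) (_ : Fin 1) => (1 : ℝ)) = 1 := by
    ext i j
    obtain rfl : i = j := Subsingleton.elim _ _
    rw [Matrix.mul_apply, Fintype.sum_unique]
    simp
  have hC₀ : ∀ (β : Fin 1) (t : Fin L → σ), A t =
      ((Matrix.of fun (_ : Fin 0 → σ) (_ : Fin 1) => (1 : ℝ))ᵀ * unfolding A 0 L (Nat.zero_add L))
        β t := by
    intro β t
    rw [Matrix.mul_apply, Fintype.sum_unique]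
    simp only [Matrix.transpose_apply, Matrix.of_apply, one_mul, unfolding]
    rw [Fin.append_left_nil _ _ rfl]
    rfl
  calc ∑ s, (A s - (ttSVD rk A).eval s) ^ 2
      = ∑ α : Fin 1, ∑ s, (A s - (ttSweep (svdSel rk) 0 L 1 (fun _ => A)).1.evalAt
          (ttSweep (svdSel rk) 0 L 1 (fun _ => A)).2 α s) ^ 2 := by
        rw [Fin.sum_univ_one]
        simp only [TensorTrain.eval_eq_evalAt _ (ttSVD_r_zero rk A) (ttSVD_lbdry rk A)]
        rfl
    _ = sweepLoss (svdSel rk) 0 L 1 (fun _ => A) :=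
        sum_sq_sub_evalAt_ttSweep (svdSel rk) hsel L 0 1 _
    _ ≤ ∑ k ∈ Finset.Ico (0 + 1) (0 + L), b k :=
        sweepLoss_le A rk b hb (svdSel rk) hsel hopt L 0 1 (Nat.zero_add L) (fun _ => A)
          (Matrix.of fun _ _ => 1) hW₀ hC₀
    _ = ∑ k ∈ Finset.Ico 1 L, b k := by rw [Nat.zero_add, Nat.zero_add]

/-- THE TT-SVD ERROR BOUND IN TERMS OF SINGULAR VALUES (Oseledets' Theorem 2.2 as usually quoted,
`ε_k² = Σ_{j > r_k} σ_j(A_⟨k⟩)²`): if the tail `Σ_{j ≥ rk k} σ_j(A_⟨k⟩)²` of the squared singular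
values of every unfolding is `≤ τ k`, then `Σ_s (A(s) − ttSVD(s))² ≤ Σ_{k=1}^{L-1} τ k`.  The distance
of `A_⟨k⟩` to rank `≤ rk k` is attained by a truncated SVD with exactly this error
(`Literature.LinearAlgebra.Matrix.exists_rank_le_sum_sq_norm_entry_sub_eq`, Eckart–Young).
[cite: Oseledets2011, §2] [cite: UschmajewVandereycken2020, §3.2] [cite: GolubVanLoan2013, §2.4] -/
theorem sum_sq_sub_eval_ttSVD_le_of_singularValues (τ : ℕ → ℝ)
    (hτ : ∀ k m (h : k + m = L), 0 < k → 0 < m →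
      ∑ j ∈ Finset.Ico (rk k) (Fintype.card (Fin m → σ)),
        (Matrix.toEuclideanLin (unfolding A k m h)).singularValues j ^ 2 ≤ τ k) :
    ∑ s, (A s - (ttSVD rk A).eval s) ^ 2 ≤ ∑ k ∈ Finset.Ico 1 L, τ k :=
  sum_sq_sub_eval_ttSVD_le rk A τ fun k m h hk hm => by
    obtain ⟨B, hB, -, hBF⟩ :=
      Literature.LinearAlgebra.Matrix.exists_rank_le_sum_sq_norm_entry_sub_eq (unfolding A k m h) (rk k)
    refine ⟨B, hB, ?_⟩
    have hnorm : ∑ i, ∑ j, ‖(unfolding A k m h - B) i j‖ ^ 2 =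
        ∑ i, ∑ j, (unfolding A k m h - B) i j ^ 2 := by
      simp only [Real.norm_eq_abs, sq_abs]
    rw [← hnorm, hBF]
    exact hτ k m h hk hm

/-- EXISTENCE FORM (Oseledets–Tyrtyshnikov): if every unfolding `A_⟨k⟩` is within `ε_k` (Frobenius)
of a matrix of rank `≤ r_k`, there is a tensor train with TT-ranks `≤ r_k` (and boundary bond
dimensions `1`) within `(Σ_k ε_k²)^{1/2}` of `A`.
[cite: OseledetsTyrtyshnikov2010, Thm 2.2] [cite: Oseledets2011, §2] -/
theorem exists_tensorTrain_sum_sq_sub_eval_le (ε : ℕ → ℝ)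
    (hε : ∀ k m (h : k + m = L), 0 < k → 0 < m →
      ∃ R : Matrix (Fin k → σ) (Fin m → σ) ℝ, R.rank ≤ rk k ∧
        ∑ s, ∑ t, (unfolding A k m h - R) s t ^ 2 ≤ ε k ^ 2) :
    ∃ T : TensorTrain ℝ σ L, T.r 0 = 1 ∧ (0 < L → T.r L = 1) ∧
      (∀ k, 0 < k → k < L → T.r k ≤ rk k) ∧
        ∑ s, (A s - T.eval s) ^ 2 ≤ ∑ k ∈ Finset.Ico 1 L, ε k ^ 2 :=
  ⟨ttSVD rk A, ttSVD_r_zero rk A, ttSVD_r_last rk A, ttSVD_r_le rk A,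
    sum_sq_sub_eval_ttSVD_le rk A (fun k => ε k ^ 2) hε⟩

/-- THE EXACT CASE (Oseledets' Theorem 2.1, constructive half): if every unfolding has rank
`rank A_⟨k⟩ ≤ rk k`, the TT-SVD with bond dimensions `≤ rk k` REPRESENTS `A` EXACTLY.
[cite: Oseledets2011, §2] [cite: UschmajewVandereycken2020, §3.2] -/
theorem eval_ttSVD_eq (hrk : ∀ k m (h : k + m = L), 0 < k → 0 < m → (unfolding A k m h).rank ≤ rk k)
    (s : Fin L → σ) : (ttSVD rk A).eval s = A s := by
  have h := sum_sq_sub_eval_ttSVD_le rk A (fun _ => 0) fun k m hkm hk hm =>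
    ⟨unfolding A k m hkm, hrk k m hkm hk hm, by simp⟩
  rw [Finset.sum_const_zero] at h
  have h0 : ∑ s, (A s - (ttSVD rk A).eval s) ^ 2 = 0 :=
    le_antisymm h (Finset.sum_nonneg fun s _ => sq_nonneg _)
  rw [Finset.sum_eq_zero_iff_of_nonneg fun s _ => sq_nonneg _] at h0
  exact (sub_eq_zero.mp ((pow_eq_zero_iff two_ne_zero).mp (h0 s (Finset.mem_univ s)))).symm

end TTSVD

/-- TT-RANKS ARE UNFOLDING RANKS (Oseledets' Theorem 2.1): every tensor `A : σ^L → ℝ` is represented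
EXACTLY by a tensor train whose `k`-th bond dimension is at most `rank A_⟨k⟩` (`0 < k < L`;
boundary bond dimensions `1`).  The converse inequality `rank A_⟨k⟩ ≤ r_k` for ANY representing train
is `TensorTrain.rank_unfolding_le`, so these ranks are optimal.
[cite: Oseledets2011, §2] [cite: UschmajewVandereycken2020, §3.2] -/
theorem exists_tensorTrain_eval_eq_rank_le {L : ℕ} (A : (Fin L → σ) → ℝ) :
    ∃ T : TensorTrain ℝ σ L, (∀ s, T.eval s = A s) ∧ T.r 0 = 1 ∧ (0 < L → T.r L = 1) ∧
      ∀ k m (h : k + m = L), 0 < k → 0 < m → T.r k ≤ (unfolding A k m h).rank := by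
  let rk : ℕ → ℕ := fun k => if hk : k ≤ L then (unfolding A k (L - k) (by omega)).rank else 0
  have hrk : ∀ k m (h : k + m = L), 0 < k → 0 < m → (unfolding A k m h).rank = rk k := by
    intro k m h hk hm
    obtain rfl : m = L - k := by omega
    simp only [rk, dif_pos (show k ≤ L by omega)]
  refine ⟨ttSVD rk A, fun s => eval_ttSVD_eq rk A (fun k m h hk hm => (hrk k m h hk hm).le) s,
    ttSVD_r_zero rk A, ttSVD_r_last rk A, fun k m h hk hm => ?_⟩
  rw [hrk k m h hk hm]
  exact ttSVD_r_le rk A k hk (by omega)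

omit [DecidableEq σ] in
/-- [folklore] `σ^k × σ^m ≃ σ^{k+m}` by concatenation of multi-indices. -/
private def appendEquiv (k m : ℕ) : (Fin k → σ) × (Fin m → σ) ≃ (Fin (k + m) → σ) where
  toFun p := Fin.append p.1 p.2
  invFun u := (fun i => u (Fin.castAdd m i), fun j => u (Fin.natAdd k j))
  left_inv p := Prod.ext (funext fun i => Fin.append_left p.1 p.2 i)
    (funext fun j => Fin.append_right p.1 p.2 j)
  right_inv _ := Fin.append_castAdd_natAdd

omit [DecidableEq σ] in
/-- [folklore] Summing a function of a multi-index over the two halves of the index separately is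
summing it over all multi-indices (the entries of the unfolding matrix are the entries of the
tensor). -/
private theorem sum_sum_append {k m N : ℕ} (h : k + m = N) (f : (Fin N → σ) → ℝ) :
    ∑ s : Fin k → σ, ∑ t : Fin m → σ, f (fun i => Fin.append s t (i.cast h.symm)) = ∑ u, f u := by
  subst h
  simp only [Fin.cast_refl, id_eq]
  rw [← Fintype.sum_prod_type']
  exact (appendEquiv k m).sum_comp f

/-- QUASI-OPTIMALITY OF THE TT-SVD (Oseledets' Corollary of Theorem 2.2): the TT-SVD with bond
dimensions `≤ rk k` is, up to the factor `√(L − 1)`, as good as the BEST tensor train with these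
bond dimensions: `Σ_s (A(s) − ttSVD(s))² ≤ (L − 1) · Σ_s (A(s) − T'(s))²` for every train `T'` with
`r'_k ≤ rk k` (`0 < k < L`).  Indeed the `k`-th unfolding of `T'` has rank `≤ r'_k`
(`TensorTrain.rank_unfolding_le`) and is within `‖A − T'‖_F` of `A_⟨k⟩`.
[cite: Oseledets2011, §2] [cite: UschmajewVandereycken2020, §3.2] -/
theorem sum_sq_sub_eval_ttSVD_le_mul (rk : ℕ → ℕ) {L : ℕ} (A : (Fin L → σ) → ℝ)
    (T' : TensorTrain ℝ σ L) (hT' : ∀ k, 0 < k → k < L → T'.r k ≤ rk k) :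
    ∑ s, (A s - (ttSVD rk A).eval s) ^ 2 ≤ ((L - 1 : ℕ) : ℝ) * ∑ s, (A s - T'.eval s) ^ 2 := by
  have h := sum_sq_sub_eval_ttSVD_le rk A (fun _ => ∑ s, (A s - T'.eval s) ^ 2)
    fun k m hkm hk hm =>
      ⟨unfolding T'.eval k m hkm,
        (TensorTrain.rank_unfolding_le T' k m hkm).trans (hT' k hk (by omega)), by
          rw [← sum_sum_append hkm (fun u => (A u - T'.eval u) ^ 2)]
          simp only [Matrix.sub_apply, unfolding, Matrix.of_apply, le_refl]⟩
  rw [Finset.sum_const, Nat.card_Ico, nsmul_eq_mul] at h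
  exact h

end Sweep

end Literature.LinearAlgebra.TensorNetworks
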